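import Literature.NumberTheory.EllipticCurves.Rubin1991.TwoVariableMainConjecture
import HarnessLib

/-!
# STUB-IDEAS k2 (gen 4) — `stub_heegnerIndexLowerAtTwo` of crux `PrintCf2.SplitBadTwoLowerHalfOfFacts`
# (stmt-BirchSwinnertonDyer-27851): typed sketch of the proposed steps

Planner seat `sidea-stub_heegnerIndexLowerAtTwo-2-g4`, technique = literature transfer
(recent-theorem / open-question harvest; typed dictionary).  This file TYPES and PROVES the
algebraic skeleton of the two transplanted devices of the idea card
`Ideas/stub-heegnerindexloweratwo-k2-g4.md`:

* §A  Viguié's «restriction to a ℤ_p-line prime to p» device (Tohoku Math. J. 65 (2013) Thm 1.1,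
      proof (7.12)–(7.16)): the cofactor `g` of the Euler-system divisibility is a unit as soon as its
      image on ONE line is a unit, and that image is pinned by the one-variable main conjecture on the
      line (at `p = 2`: Müller 2020 Thm 1.1) once every ideal in sight is prime to `p` (μ = 0:
      Oukhaba–Viguié 2016 Thm 1.2).  `A1`–`A5` are PROVED abstract algebra; the research inputs of the
      road (two-variable Euler-system divisibility at 2, the control identity (7.15) at 2) enter as the
      named hypotheses `h14`, `h15`, `h16` of `A5`.
* §B  Plan 3 (remarks for the critic's line road): Müller's χ-quotient `M ⊗_{ℤ₂[Δ]} ℤ₂(sgn)` for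
      `Δ = {±1}` IS the minus quotient `M ⧸ (c+1)M` of the critic's Δ-sandwich (`B1`), so Müller 2020
      Thm 1.1 (i) — which is stated PER χ-QUOTIENT for `[L′:K]` even — speaks about the minus quotients of
      the class-group / global-unit modules directly (no total identity, no norm trick); and for the LOWER
      containment any explicit extra factor on the elliptic-unit side of a generator comparison is
      harmless (`B2`, `B3`).  CAUTION (orientation): Müller's Thm 1.1 (ii) / Cor 4.3 concern the
      𝔭-ramified module and the units AT THE TOWER PRIME 𝔭 (classical side); the critic's `Y = X^{(𝔭̄)}(F_∞)`
      and `U_𝔭̄` are the MIXED side, reached from Thm 1.1 (i) (prime-independent) plus the local brick at 𝔭̄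
      (their R2c, research-M) — `B3` takes that 𝔭̄-side identity as the hypothesis `hR2`.
* §C  the same two chains in the currency of road α's S3a (`Module.charIdeal` over `IwasawaAlgebra₂ 2`,
      generator `G₂`, specialisation `J''`), as PROVED one-line reductions.

No `sorry` in this file.  Nothing here closes a stub, a crux or a route; the two-variable main
conjecture at `p = 2` with `2 ∣ #G` is NOT proved here (it is the research input named in §A);
BSD is not proved by any of this.
-/

noncomputable section

open scoped Classical

set_option autoImplicit false
set_option linter.dupNamespace false
set_option linter.unusedVariables false

open Literature.NumberTheory.EllipticCurves

namespace Summit.BirchSwinnertonDyer.BirchSwinnertonDyer.Cruxes.SplitBadTwoLowerHalfOfFacts.StubIdeasK2G4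

/-! ## §A  Viguié's line-restriction device (abstract, proved) -/

/-- **A1** (local-hom unit lift for the augmentation `Λ⟦Ῡ⟧ → Λ`): a power series whose constant
coefficient is a unit is a unit.  This is the step «the image of `g` in `ℤ_p[χ]⟦Υ′⟧` is a unit, hence
`g` is a unit of `Λ_{∞,χ}`» at the end of Viguié's proof (p. 464). -/
theorem A1_isUnit_of_isUnit_constantCoeff {B : Type*} [CommRing B] (f : PowerSeries B)
    (h : IsUnit (PowerSeries.constantCoeff f)) : IsUnit f :=
  PowerSeries.isUnit_iff_constantCoeff.mpr h

/-- **A2** (Viguié's unit trick, abstract form).  `Λ` = the two-variable algebra, `B` = the algebra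
of the line (a domain), `φ` = restriction to the line, assumed to reflect units (true for the
augmentation of one variable, `A1`).  Data: `a` = char of the class-group side, `e` = char of
units mod elliptic units (two-variable), `a₀ e₀` their one-variable analogues on the line.
Hypotheses: (7.14) Euler-system divisibility with cofactor `g`; (7.15) the control identity on the
line; (7.16) the one-variable main conjecture on the line; non-vanishing (= «prime to p», μ = 0).
Conclusion: the cofactor is a unit, i.e. the two-variable EQUALITY. -/
theorem A2_isUnit_cofactor_of_lineRestriction {Λ B : Type*} [CommRing Λ] [CommRing B] [IsDomain B]
    (φ : Λ →+* B) (hloc : ∀ g : Λ, IsUnit (φ g) → IsUnit g)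
    {g a e : Λ} {a₀ e₀ : B}
    (h14 : g * a = e) (h15 : φ a * e₀ = φ e * a₀) (h16 : Associated e₀ a₀)
    (ha : φ a ≠ 0) (ha₀ : a₀ ≠ 0) : IsUnit g := by
  obtain ⟨u, hu⟩ := h16
  have he₀ : e₀ ≠ 0 := by
    rintro rfl
    simp at hu
    exact ha₀ hu.symm
  have h : φ a * e₀ = φ g * φ a * (e₀ * ↑u) := by
    rw [hu, ← map_mul, h14]; exact h15
  have h' : (φ a * e₀) * 1 = (φ a * e₀) * (φ g * ↑u) := by
    rw [mul_one]
    calc φ a * e₀ = φ g * φ a * (e₀ * ↑u) := h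
      _ = φ a * e₀ * (φ g * ↑u) := by ring
  have h1 : (1 : B) = φ g * ↑u := mul_left_cancel₀ (mul_ne_zero ha he₀) h'
  exact hloc g (isUnit_iff_exists_inv.mpr ⟨↑u, h1.symm⟩)

/-- **A2′** The instance actually used: `Λ = B⟦Ῡ⟧` (second variable adjoined to the line algebra
`B = ℤ_p[χ]⟦Υ′⟧`), `φ` = constant coefficient in `Ῡ` (= restriction to the line `K_{∞,0}`). -/
theorem A2'_isUnit_cofactor_powerSeries {B : Type*} [CommRing B] [IsDomain B]
    {g a e : PowerSeries B} {a₀ e₀ : B}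
    (h14 : g * a = e)
    (h15 : PowerSeries.constantCoeff a * e₀ = PowerSeries.constantCoeff e * a₀)
    (h16 : Associated e₀ a₀) (ha : PowerSeries.constantCoeff a ≠ 0) (ha₀ : a₀ ≠ 0) : IsUnit g :=
  A2_isUnit_cofactor_of_lineRestriction (PowerSeries.constantCoeff) (fun f hf =>
    A1_isUnit_of_isUnit_constantCoeff f hf) h14 h15 h16 ha ha₀

/-- **A3** («prime to p» rigidity: a relation that holds after inverting `p` holds integrally once
both sides are prime to `p`; this is how (7.6), an identity in `ℚ ⊗ Λ_{Υ′}`, becomes (7.15) in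
`ℤ_p[χ]⟦Υ′⟧` — the place where μ = 0 (Gillard for p ≥ 5; Oukhaba–Viguié 2016 Thm 1.2 for all p) is
consumed). -/
theorem A3_associated_of_associated_pow_mul {A : Type*} [CommRing A] [IsDomain A]
    {p x y : A} (hp : Prime p) (hx : ¬ p ∣ x) (hy : ¬ p ∣ y) {m n : ℕ}
    (h : Associated (p ^ m * x) (p ^ n * y)) : Associated x y := by
  obtain ⟨u, hu⟩ := h
  rcases lt_trichotomy m n with hlt | heq | hgt
  · obtain ⟨k, rfl⟩ := Nat.exists_eq_add_of_lt hlt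
    have h1 : p ^ m * (x * ↑u) = p ^ m * (p ^ (k + 1) * y) := by
      rw [← mul_assoc, hu]; ring
    have h2 := mul_left_cancel₀ (pow_ne_zero m hp.ne_zero) h1
    have h3 : p ∣ x * ↑u := ⟨p ^ k * y, by rw [h2]; ring⟩
    rcases hp.dvd_or_dvd h3 with h4 | h4
    · exact absurd h4 hx
    · exact absurd (isUnit_of_dvd_unit h4 u.isUnit) hp.not_unit
  · subst heq
    refine ⟨u, mul_left_cancel₀ (pow_ne_zero m hp.ne_zero) ?_⟩
    rw [← hu]; ring
  · obtain ⟨k, rfl⟩ := Nat.exists_eq_add_of_lt hgt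
    have h1 : p ^ n * (p ^ (k + 1) * x * ↑u) = p ^ n * y := by
      rw [← hu]; ring
    have h2 := mul_left_cancel₀ (pow_ne_zero n hp.ne_zero) h1
    have h3 : p ∣ y := ⟨p ^ k * x * ↑u, by rw [← h2]; ring⟩
    exact absurd h3 hy

/-- **A4** (degree count; the robustness variant of (7.16) at `p = 2`: one-variable DIVISIBILITY per
character — Müller 2020 Cor 3.25 / Viguié arXiv:1103.1125 — plus EQUALITY OF TOTAL λ-INVARIANTS —
Oukhaba–Viguié 2016 (41) — give equality, via an additive `ℕ`-valued degree `d` vanishing exactly on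
units; over `𝒪⟦T⟧` with μ = 0, `d` = the Weierstrass degree λ). -/
theorem A4_associated_of_dvd_of_degree_eq {A : Type*} [CommRing A] [IsDomain A]
    (d : A → ℕ) (hd_mul : ∀ x y : A, x ≠ 0 → y ≠ 0 → d (x * y) = d x + d y)
    (hd_unit : ∀ x : A, x ≠ 0 → (d x = 0 ↔ IsUnit x))
    {f g : A} (hg : g ≠ 0) (hfg : f ∣ g) (hdeg : d f = d g) : Associated f g := by
  obtain ⟨h, rfl⟩ := hfg
  obtain ⟨hf0, hh0⟩ := mul_ne_zero_iff.mp hg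
  have h1 : d h = 0 := by
    have := hd_mul f h hf0 hh0
    omega
  obtain ⟨u, hu⟩ := (hd_unit h hh0).mp h1
  exact ⟨u, by rw [hu]⟩

/-- **A5** (the whole Viguié assembly as one implication between principal ideals: two-variable
EQUALITY `(a) = (e)` from the Euler-system divisibility (7.14), the line identity (7.15) and the
one-variable main conjecture (7.16) on the line; over a domain `Λ`).  At `p = 2` with `2 ∣ #G` the
hypotheses `h14` (two-variable Euler system at 2) and `h15` (Viguié §7 control algebra at 2) are the
RESEARCH inputs, `h16` is Müller 2020 Thm 1.1, `ha`/`ha₀` are μ = 0 (Oukhaba–Viguié 2016). -/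
theorem A5_span_eq_of_viguieInputs {Λ B : Type*} [CommRing Λ] [IsDomain Λ] [CommRing B] [IsDomain B]
    (φ : Λ →+* B) (hloc : ∀ g : Λ, IsUnit (φ g) → IsUnit g)
    {g a e : Λ} {a₀ e₀ : B}
    (h14 : g * a = e) (h15 : φ a * e₀ = φ e * a₀) (h16 : Associated e₀ a₀)
    (ha : φ a ≠ 0) (ha₀ : a₀ ≠ 0) :
    Ideal.span ({a} : Set Λ) = Ideal.span {e} := by
  have hg : IsUnit g := A2_isUnit_cofactor_of_lineRestriction φ hloc h14 h15 h16 ha ha₀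
  obtain ⟨u, rfl⟩ := hg
  rw [← h14, mul_comm]
  exact (Ideal.span_singleton_mul_right_unit u.isUnit a).symm

/-! ## §B  Plan 2: Müller's χ-quotient for `Δ = {±1}` is the minus quotient; harmless factors -/

section Minus

variable {R : Type*} [CommRing R] {M : Type*} [AddCommGroup M] [Module R M]

/-- **B1** The χ = sgn quotient of a module with an involution `c` (Müller 2020 p. 3:
`M_χ = M ⊗_{ℤ₂[H]} ℤ₂(χ)`, «the largest quotient on which H acts via χ», here `H = Δ = ⟨c⟩`):
`M ⧸ (c + 1)M`.  This is literally the minus quotient `Y/(c+1)Y` of the critic's Δ-sandwich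
(STUB-PLAN v1.5 §1 k1-g3), so Müller's Theorem 1.1 (i) at `χ = sgn` (class groups vs global units,
per χ-quotient, even `[L′:K]` allowed) speaks about the minus quotients `A_∞(F_∞)/(c+1)`,
`(Ē/C̄)/(c+1)` directly. -/
def minusQuot (c : M →ₗ[R] M) : Type _ := M ⧸ LinearMap.range (c + LinearMap.id)

instance (c : M →ₗ[R] M) : AddCommGroup (minusQuot c) :=
  inferInstanceAs (AddCommGroup (M ⧸ LinearMap.range (c + LinearMap.id)))

instance (c : M →ₗ[R] M) : Module R (minusQuot c) :=
  inferInstanceAs (Module R (M ⧸ LinearMap.range (c + LinearMap.id)))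

/-- On the sgn-quotient the involution acts as `−1` (so `Δ` acts through `sgn`, i.e. this IS the
largest quotient on which `Δ` acts via the sign character). -/
theorem B1_mk_involution_eq_neg (c : M →ₗ[R] M) (m : M) :
    (Submodule.Quotient.mk (c m) : M ⧸ LinearMap.range (c + LinearMap.id)) =
      - Submodule.Quotient.mk m := by
  rw [eq_neg_iff_add_eq_zero, ← Submodule.Quotient.mk_add, Submodule.Quotient.mk_eq_zero]
  exact ⟨m, by simp⟩

/-- Universal property half: any quotient map `π : M → N` on whose target `c` acts as `−1` kills
`(c+1)M`, hence factors through the sgn-quotient («largest such quotient»). -/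
theorem B1'_range_le_ker_of_acts_neg (c : M →ₗ[R] M) {N : Type*} [AddCommGroup N] [Module R N]
    (π : M →ₗ[R] N) (hπ : ∀ m, π (c m) = - π m) :
    LinearMap.range (c + LinearMap.id) ≤ LinearMap.ker π := by
  rintro x ⟨m, rfl⟩
  simp [hπ m]

end Minus

/-- **B2** (harmless factors for the LOWER containment): if the generator `F` produced on the
elliptic-unit side of the line is an explicit multiple `e * G` of the restricted two-variable generator
`G = G∣_ℓ` (normalisation factors: `w_K = 2`, `12`-th powers, norm-defined `C(L′) = N C(L)` vs
Katz–de Shalit units, Gauss sums, auxiliary-`α` twistors `(Nα − σ_α)` — the critic's P-norm list, all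
placed on the `F` side), then `(F) ⊆ (G)`: the containment LOWER consumes survives every such factor
(their `ord₂` at the point is booked in T3's `e_M`, B8 — not here). -/
theorem B2_span_singleton_le_of_eq_mul {A : Type*} [CommRing A] {F G e : A} (h : F = e * G) :
    Ideal.span ({F} : Set A) ≤ Ideal.span {G} :=
  Ideal.span_singleton_le_span_singleton.mpr ⟨e, by rw [h, mul_comm]⟩

/-- **B2′** The same after a ring map `φ` (restriction to the line / the specialisation `J''`). -/
theorem B2'_map_span_singleton_le_of_eq_mul {A B : Type*} [CommRing A] [CommRing B] (φ : A →+* B)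
    {F G e : A} (h : F = e * G) :
    (Ideal.span ({F} : Set A)).map φ ≤ Ideal.span {φ G} := by
  rw [Ideal.map_span, Set.image_singleton]
  exact Ideal.span_singleton_le_span_singleton.mpr ⟨φ e, by rw [h, map_mul, mul_comm]⟩

/-- **B3** (the T1⁻ chain on the line as one implication between ideals of the line algebra `B`):
`hR2` = the 𝔭̄-side identity `char(Y_sgn) = (F)` on the line (critic's R2ab per χ-quotient, PRINT via
Müller Thm 1.1 (i) + Leopoldt, composed with R2c, the local brick at 𝔭̄ — research-M, NOT supplied
here); `hminus` = the pinned identification `char(D.X) = char(Y_sgn)` (P-carrier); `hcmp` = the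
generator comparison `F = e * G∣_ℓ` (P-norm); conclusion `char(D.X) ⊆ (G∣_ℓ)` = what the stub's T1⁻
consumes.  Recorded only to fix DIRECTIONS: every normalisation factor may sit on the `F` side. -/
theorem B3_lineContainment_of_chain {B : Type*} [CommRing B]
    {charDX charYsgn : Ideal B} {F G e : B}
    (hR2 : charYsgn = Ideal.span {F}) (hminus : charDX = charYsgn) (hcmp : F = e * G) :
    charDX ≤ Ideal.span {G} := by
  rw [hminus, hR2]
  exact B2_span_singleton_le_of_eq_mul hcmp

/-! ## §C  The same chains in road α's S3a currency (`IwasawaAlgebra₂ 2`, `G₂`, `J''`) -/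

section S3aCurrency

variable (X : Type) [AddCommGroup X] [Module (IwasawaAlgebra₂ 2) X]

/-- The specialisation map `J'' = PowerSeries.map (PowerSeries.map J)` of road α (v9.1 :183 / v10.x),
for a coefficient embedding `J : ℤ₂ →+* 𝒪`. -/
abbrev Jpp {𝒪 : Type*} [CommRing 𝒪] (J : ℤ_[2] →+* 𝒪) :
    IwasawaAlgebra₂ 2 →+* PowerSeries (PowerSeries 𝒪) :=
  PowerSeries.map (PowerSeries.map J)

/-- **C1** S3a's EQUALITY `J''(char X) = (G₂)` yields the containment half T1⁻ consumes (and, over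
the UFD `Λ₂`, k1-g4's `(E₂-Fitt♭)` since `Fitt₀ ⊆ char`); recorded to make the direction explicit:
the Viguié road (§A) delivers equality, of which LOWER uses `≤` and UPPER uses `≥`. -/
theorem C1_charIdeal_map_le_of_eq {𝒪 : Type*} [CommRing 𝒪] (J : ℤ_[2] →+* 𝒪)
    (G₂ : PowerSeries (PowerSeries 𝒪))
    (hS3a : (Module.charIdeal (IwasawaAlgebra₂ 2) X).map (Jpp J) = Ideal.span {G₂}) :
    (Module.charIdeal (IwasawaAlgebra₂ 2) X).map (Jpp J) ≤ Ideal.span {G₂} ∧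
      Ideal.span {G₂} ≤ (Module.charIdeal (IwasawaAlgebra₂ 2) X).map (Jpp J) :=
  ⟨le_of_eq hS3a, le_of_eq hS3a.symm⟩

/-- **C2** (translation of Viguié's prime-free theorem into S3a currency, generators version over a
domain `Λ`): from the four-term sequence `0 → E/C → U/C → X → A → 0` (multiplicativity:
`cU · cA ~ cX · cEC`), Viguié-at-2 (`cA ~ cEC`, the GLOBAL, prime-independent identity) and the local
brick (`cU ~ G`: semi-local units modulo elliptic units ↦ the measure — de Shalit II.4 shape at `p = 2`,
the LEAD's gap (β); one-variable rung in print: Müller 2020 Lemma 4.1–Cor. 4.3 via Kezuka's thesis),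
conclude `cX ~ G`, i.e. `char X = (G)`. -/
theorem C2_associated_charX_of_fourTerm {Λ : Type*} [CommRing Λ] [IsDomain Λ]
    {cU cA cX cEC G : Λ}
    (h4 : Associated (cU * cA) (cX * cEC)) (hViguie : Associated cA cEC) (hYager : Associated cU G)
    (hEC : cEC ≠ 0) : Associated cX G := by
  have h1 : Associated (cX * cEC) (G * cEC) := h4.symm.trans (hYager.mul_mul hViguie)
  exact Associated.of_mul_right h1 (Associated.refl cEC) hEC

/-- **C2′** ideal form of `C2`'s conclusion. -/
theorem C2'_span_eq_of_associated {Λ : Type*} [CommRing Λ] [IsDomain Λ] {cX G : Λ}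
    (h : Associated cX G) :
    Ideal.span ({cX} : Set Λ) = Ideal.span {G} :=
  Ideal.span_singleton_eq_span_singleton.mpr h

end S3aCurrency

end Summit.BirchSwinnertonDyer.BirchSwinnertonDyer.Cruxes.SplitBadTwoLowerHalfOfFacts.StubIdeasK2G4

end
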